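import Summits.CriticalPhenomena.CardyFormulaZ2.Theses.CardyQContinuation
import Literature.Probability.RandomPlanarGeometry.ChordalBoundary
import Literature.Probability.RandomPlanarGeometry.ConformalMapCaratheodoryProofs

/-!
# Crux `IsingJetsConformal`, stub `stub_higherJetLimitsConformal`: the Möbius geometry of
# "equal cross-ratio" (route `CardyQContinuation`, item stmt-CriticalPhenomena-5560)

The registered stub `stub_higherJetLimitsConformal` (line `Cruxes/IsingJetsConformal/Lines/
birth.lean`) asks, for `n ≥ 1`: if conformal rectangles `R`, `R'` carry uniformizing data
`(φ, x)`, `(φ', x')` with `crossRatio x = crossRatio x'`, then the `δ → 0⁺` limits of the `n`-th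
`s`-jets at `s = √2` of the self-dual FK crossing ratios of `R` and `R'` coincide. Its content —
conformal covariance of the higher FK-Ising jet limits — is new mathematics and is NOT proved
here. This file proves, sorry-free, everything the hypothesis `crossRatio x = crossRatio x'` buys,
i.e. the exact geometric input through which covariance would enter:

* `exists_realMoebius_of_crossRatio_eq`: two injective real quadruples of equal Cardy cross-ratio
  are related by a real Möbius map `t ↦ (a t + b)/(c t + d)`, `ad - bc ≠ 0`, finite at the four
  points (three points determine the map, the fourth matches iff the cross-ratios agree);
* `realMoebius_det_pos_iff`: for monotone-or-antitone quadruples ANY such map has `ad - bc > 0`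
  exactly when `x`, `x'` have the same orientation (`realMoebius_det_pos`: a real Möbius map
  increasing on three points has positive determinant);
* `exists_conformalEquiv_upperHalfPlaneSet_of_crossRatio_eq` /
  `not_exists_conformalEquiv_upperHalfPlaneSet_of_orientation_ne`: hence a conformal automorphism
  of `ℍₒ` with boundary values `xᵢ ↦ x'ᵢ` exists iff the orientations agree (`Aut(ℍₒ) = PSL(2, ℝ)`,
  `ConformalEquiv.exists_specialLinearGroup_eq`, and `moebius_boundaryValue`); in the opposite case
  the anti-conformal reflection `z ↦ M(-z̄)`, `M` the positive map through `-x` and `x'`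
  (`crossRatio_neg`), does it;
* `exists_isUniformizing_of_crossRatio_eq`, `exists_conformalEquiv_hasBoundaryValue_pt`: for
  domains, same orientation + equal cross-ratio give a datum of `R'` with the SAME quadruple `x`,
  hence (Carathéodory) a conformal equivalence `Ψ : Ω → Ω'` with boundary values `R.pt i ↦ R'.pt i`;
* `isUniformizing_strictMono_iff`: the orientation of a uniformizing quadruple is an invariant
  (chirality) of the rectangle, so the stub splits into exactly two cases: `R' ≅ R` as marked
  domains, or `R' ≅` the conjugate rectangle of `R` (tree: `MarkedDomain.conjugate`,
  `MarkedDomain.IsUniformizing.exists_conjugate`, mirror datum `(z ↦ conj (φ (-z̄)), -x)`).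

Left for the stub (new mathematics): (1) COVARIANCE of the jet limits under conformal equivalences
of marked rectangles; (2) MIRROR SYMMETRY of the jet limits (lattice reflection symmetry of the FK
model on `δℤ²`). `stub_higherJetLimitsConformal_markedEquivalence` is the registered form (sub-goal
of stub 3) of `exists_conformalEquiv_hasBoundaryValue_pt`. Ahlfors, *Complex Analysis*, Ch. 3 §3.1.
-/

namespace Summit.CriticalPhenomena.CardyFormulaZ2.Theorems.CardyQContinuation

open Filter Set Metric
open scoped Topology
open Literature.Probability.RandomPlanarGeometry
open UpperHalfPlane (upperHalfPlaneSet)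

/-! ### Real Möbius maps on the line: the difference formula and the sign of the determinant -/

/-- **Difference formula** for a real Möbius map at two regular points:
`M s - M t = (ad - bc)(s - t)/((cs + d)(ct + d))`. [cite: AhlforsCA1979, Ch. 3 §3.1] -/
theorem realMoebius_sub {a b c d s t : ℝ} (hs : c * s + d ≠ 0) (ht : c * t + d ≠ 0) :
    (a * s + b) / (c * s + d) - (a * t + b) / (c * t + d) =
      (a * d - b * c) * (s - t) / ((c * s + d) * (c * t + d)) := by
  rw [div_sub_div _ _ hs ht]; congr 1; ring

/-- If a real Möbius map is increasing on a pair `s < t` of regular points, then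
`(ad - bc)(cs + d)(ct + d) > 0`. [folklore] -/
theorem realMoebius_det_mul_pos {a b c d s t : ℝ} (hs : c * s + d ≠ 0) (ht : c * t + d ≠ 0)
    (hst : s < t) (hlt : (a * s + b) / (c * s + d) < (a * t + b) / (c * t + d)) :
    0 < (a * d - b * c) * ((c * s + d) * (c * t + d)) := by
  have hpos : 0 < (a * d - b * c) * (t - s) / ((c * t + d) * (c * s + d)) := by
    rw [← realMoebius_sub ht hs]
    exact sub_pos.2 hlt
  have h1 : 0 < (a * d - b * c) * (t - s) * ((c * t + d) * (c * s + d)) := by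
    rcases div_pos_iff.1 hpos with ⟨hn, hd⟩ | ⟨hn, hd⟩
    · exact mul_pos hn hd
    · exact mul_pos_of_neg_of_neg hn hd
  have e : (a * d - b * c) * (t - s) * ((c * t + d) * (c * s + d)) =
      (a * d - b * c) * ((c * s + d) * (c * t + d)) * (t - s) := by ring
  rw [e] at h1
  exact (mul_pos_iff_of_pos_right (sub_pos.2 hst)).1 h1

/-- **A real Möbius map increasing on three points has positive determinant**: if `t₀ < t₁ < t₂`
are regular points of `t ↦ (a t + b)/(c t + d)` with increasing images then `ad - bc > 0` (the
three products `(ad - bc)(ctᵢ + d)(ctⱼ + d)` are positive and two of them multiply to a square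
times the third denominator pair). [cite: AhlforsCA1979, Ch. 3 §3.1] -/
theorem realMoebius_det_pos {a b c d t₀ t₁ t₂ : ℝ} (h₀ : c * t₀ + d ≠ 0) (h₁ : c * t₁ + d ≠ 0)
    (h₂ : c * t₂ + d ≠ 0) (ht₀₁ : t₀ < t₁) (ht₁₂ : t₁ < t₂)
    (hu₀₁ : (a * t₀ + b) / (c * t₀ + d) < (a * t₁ + b) / (c * t₁ + d))
    (hu₁₂ : (a * t₁ + b) / (c * t₁ + d) < (a * t₂ + b) / (c * t₂ + d)) :
    0 < a * d - b * c := by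
  have hA := realMoebius_det_mul_pos h₀ h₁ ht₀₁ hu₀₁
  have hB := realMoebius_det_mul_pos h₁ h₂ ht₁₂ hu₁₂
  have hC := realMoebius_det_mul_pos h₀ h₂ (ht₀₁.trans ht₁₂) (hu₀₁.trans hu₁₂)
  have hD : a * d - b * c ≠ 0 := fun hD ↦ by rw [hD, zero_mul] at hA; exact lt_irrefl _ hA
  have hsq : 0 < ((a * d - b * c) * (c * t₁ + d)) ^ 2 := sq_pos_of_ne_zero (mul_ne_zero hD h₁)
  have hAB := mul_pos hA hB
  have e : (a * d - b * c) * ((c * t₀ + d) * (c * t₁ + d)) *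
      ((a * d - b * c) * ((c * t₁ + d) * (c * t₂ + d))) =
      ((a * d - b * c) * (c * t₁ + d)) ^ 2 * ((c * t₀ + d) * (c * t₂ + d)) := by ring
  rw [e] at hAB
  exact (mul_pos_iff_of_pos_right ((mul_pos_iff_of_pos_left hsq).1 hAB)).1 hC

/-- **A real Möbius map decreasing on three points has negative determinant** (apply
`realMoebius_det_pos` to the negated map `-(a t + b)/(c t + d)`). [folklore] -/
theorem realMoebius_det_neg {a b c d t₀ t₁ t₂ : ℝ} (h₀ : c * t₀ + d ≠ 0) (h₁ : c * t₁ + d ≠ 0)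
    (h₂ : c * t₂ + d ≠ 0) (ht₀₁ : t₀ < t₁) (ht₁₂ : t₁ < t₂)
    (hu₀₁ : (a * t₁ + b) / (c * t₁ + d) < (a * t₀ + b) / (c * t₀ + d))
    (hu₁₂ : (a * t₂ + b) / (c * t₂ + d) < (a * t₁ + b) / (c * t₁ + d)) :
    a * d - b * c < 0 := by
  have hneg : ∀ t, (-a * t + -b) / (c * t + d) = -((a * t + b) / (c * t + d)) := fun t ↦ by
    rw [← neg_div]; congr 1; ring
  have h := realMoebius_det_pos (a := -a) (b := -b) h₀ h₁ h₂ ht₀₁ ht₁₂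
    (by rw [hneg, hneg]; exact neg_lt_neg hu₀₁) (by rw [hneg, hneg]; exact neg_lt_neg hu₁₂)
  linarith

/-! ### Equal cross-ratio: the real Möbius map through two quadruples -/

/-- **Three points and the cross-ratio determine a real Möbius map.** Two injective real
quadruples `x`, `y` of equal Cardy cross-ratio are related by a real Möbius map of non-zero
determinant, finite at the four points: `(a xᵢ + b)/(c xᵢ + d) = yᵢ`. The map through
`(x₀, x₁, x₂) ↦ (y₀, y₁, y₂)` is explicit (`T_y⁻¹ ∘ T_x`, `T_t : t₀, t₁, t₂ ↦ 0, 1, ∞`) and sends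
`x₃ ↦ y₃` because the cross-ratios agree; no monotonicity is needed (cf. the tree's increasing,
positive-determinant case `LatticeModels.SquareTiling.exists_moebius_of_crossRatio_eq`).
[cite: AhlforsCA1979, Ch. 3 §3.1] -/
theorem exists_realMoebius_of_crossRatio_eq {x y : Fin 4 → ℝ} (hx : Function.Injective x)
    (hy : Function.Injective y) (hcr : crossRatio x = crossRatio y) :
    ∃ a b c d : ℝ, a * d - b * c ≠ 0 ∧
      ∀ i : Fin 4, c * x i + d ≠ 0 ∧ (a * x i + b) / (c * x i + d) = y i := by
  -- adapted from `UniformizingNormalForm.exists_isUniformizing_of_crossRatio_eq` (roles of the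
  -- two quadruples exchanged; injectivity replaces monotonicity)
  have X : ∀ {i j : Fin 4}, i ≠ j → x i - x j ≠ 0 := fun h ↦ sub_ne_zero.2 (hx.ne h)
  have Y : ∀ {i j : Fin 4}, i ≠ j → y i - y j ≠ 0 := fun h ↦ sub_ne_zero.2 (hy.ne h)
  -- the cross-ratio identity, denominators cleared
  have hcr' : (x 0 - x 1) * (x 2 - x 3) * ((y 0 - y 2) * (y 1 - y 3)) =
      (y 0 - y 1) * (y 2 - y 3) * ((x 0 - x 2) * (x 1 - x 3)) := by
    unfold crossRatio at hcr
    rw [div_eq_div_iff (mul_ne_zero (X (by decide)) (X (by decide)))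
      (mul_ne_zero (Y (by decide)) (Y (by decide)))] at hcr
    linarith
  set P : ℝ := (y 1 - y 0) * (x 1 - x 2) with hP
  set Q : ℝ := (y 1 - y 2) * (x 1 - x 0) with hQ
  have hPne : P ≠ 0 := mul_ne_zero (Y (by decide)) (X (by decide))
  have hQne : Q ≠ 0 := mul_ne_zero (Y (by decide)) (X (by decide))
  have hPQ : P * Q * ((y 2 - y 0) * (x 2 - x 0)) ≠ 0 :=
    mul_ne_zero (mul_ne_zero hPne hQne) (mul_ne_zero (Y (by decide)) (X (by decide)))
  refine ⟨P * y 2 - Q * y 0, -P * y 2 * x 0 + Q * y 0 * x 2, P - Q, -P * x 0 + Q * x 2, ?_, ?_⟩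
  · -- the determinant factorises as `P Q (y₂ - y₀)(x₂ - x₀)`
    have e : (P * y 2 - Q * y 0) * (-P * x 0 + Q * x 2) - (-P * y 2 * x 0 + Q * y 0 * x 2) * (P - Q) =
        P * Q * ((y 2 - y 0) * (x 2 - x 0)) := by ring
    rwa [e]
  · -- `a xᵢ + b = yᵢ (c xᵢ + d)`: by `ring` for `i ≤ 2`, by the cross-ratio identity for `i = 3`
    have hnum0 : (P * y 2 - Q * y 0) * x 0 + (-P * y 2 * x 0 + Q * y 0 * x 2) =
        y 0 * ((P - Q) * x 0 + (-P * x 0 + Q * x 2)) := by ring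
    have hnum1 : (P * y 2 - Q * y 0) * x 1 + (-P * y 2 * x 0 + Q * y 0 * x 2) =
        y 1 * ((P - Q) * x 1 + (-P * x 0 + Q * x 2)) := by
      simp only [hP, hQ]; ring
    have hnum2 : (P * y 2 - Q * y 0) * x 2 + (-P * y 2 * x 0 + Q * y 0 * x 2) =
        y 2 * ((P - Q) * x 2 + (-P * x 0 + Q * x 2)) := by ring
    have hnum3 : (P * y 2 - Q * y 0) * x 3 + (-P * y 2 * x 0 + Q * y 0 * x 2) =
        y 3 * ((P - Q) * x 3 + (-P * x 0 + Q * x 2)) := by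
      simp only [hP, hQ]; linear_combination -hcr'
    have hnum : ∀ i : Fin 4, (P * y 2 - Q * y 0) * x i + (-P * y 2 * x 0 + Q * y 0 * x 2) =
        y i * ((P - Q) * x i + (-P * x 0 + Q * x 2)) := by
      intro i; fin_cases i; exacts [hnum0, hnum1, hnum2, hnum3]
    -- the denominators: explicit for `i ≤ 2`; for `i = 3` a zero denominator would put `(x₃, 1)`
    -- in the kernel of a matrix of non-zero determinant
    have hden0 : (P - Q) * x 0 + (-P * x 0 + Q * x 2) ≠ 0 := by
      have e : (P - Q) * x 0 + (-P * x 0 + Q * x 2) = Q * (x 2 - x 0) := by ring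
      rw [e]; exact mul_ne_zero hQne (X (by decide))
    have hden1 : (P - Q) * x 1 + (-P * x 0 + Q * x 2) ≠ 0 := by
      have e : (P - Q) * x 1 + (-P * x 0 + Q * x 2) = (x 1 - x 2) * (x 1 - x 0) * (y 2 - y 0) := by
        simp only [hP, hQ]; ring
      rw [e]; exact mul_ne_zero (mul_ne_zero (X (by decide)) (X (by decide))) (Y (by decide))
    have hden2 : (P - Q) * x 2 + (-P * x 0 + Q * x 2) ≠ 0 := by
      have e : (P - Q) * x 2 + (-P * x 0 + Q * x 2) = P * (x 2 - x 0) := by ring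
      rw [e]; exact mul_ne_zero hPne (X (by decide))
    have hden3 : (P - Q) * x 3 + (-P * x 0 + Q * x 2) ≠ 0 := fun h0 ↦ by
      have h1 : (P * y 2 - Q * y 0) * x 3 + (-P * y 2 * x 0 + Q * y 0 * x 2) = 0 := by
        rw [hnum 3, h0, mul_zero]
      exact hPQ (by linear_combination (P * y 2 - Q * y 0) * h0 - (P - Q) * h1)
    have hden : ∀ i : Fin 4, (P - Q) * x i + (-P * x 0 + Q * x 2) ≠ 0 := by
      intro i; fin_cases i; exacts [hden0, hden1, hden2, hden3]
    exact fun i ↦ ⟨hden i, (div_eq_iff (hden i)).2 (hnum i)⟩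

/-- **The sign of the determinant is the relative orientation.** Let `x`, `y` be real quadruples,
each strictly increasing or strictly decreasing, and `t ↦ (a t + b)/(c t + d)` ANY real Möbius
map finite at the `xᵢ` with `xᵢ ↦ yᵢ`. Then `ad - bc > 0` iff `x` and `y` have the same
orientation; otherwise `ad - bc < 0` (`realMoebius_det_pos` / `realMoebius_det_neg` on
`x₀, x₁, x₂`). [cite: AhlforsCA1979, Ch. 3 §3.1] -/
theorem realMoebius_det_pos_iff {x y : Fin 4 → ℝ} (hx : StrictMono x ∨ StrictAnti x)
    (hy : StrictMono y ∨ StrictAnti y) {a b c d : ℝ}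
    (hM : ∀ i : Fin 4, c * x i + d ≠ 0 ∧ (a * x i + b) / (c * x i + d) = y i) :
    0 < a * d - b * c ↔ (StrictMono x ↔ StrictMono y) := by
  have h01 : (0 : Fin 4) < 1 := by decide
  have h12 : (1 : Fin 4) < 2 := by decide
  have nx : StrictMono x → ¬StrictAnti x := fun h h' ↦ lt_asymm (h h01) (h' h01)
  have ny : StrictMono y → ¬StrictAnti y := fun h h' ↦ lt_asymm (h h01) (h' h01)
  have e := fun i ↦ (hM i).2
  rcases hx with hx | hx <;> rcases hy with hy | hy
  · have h := realMoebius_det_pos (hM 0).1 (hM 1).1 (hM 2).1 (hx h01) (hx h12)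
      (by rw [e, e]; exact hy h01) (by rw [e, e]; exact hy h12)
    exact iff_of_true h (iff_of_true hx hy)
  · have h := realMoebius_det_neg (hM 0).1 (hM 1).1 (hM 2).1 (hx h01) (hx h12)
      (by rw [e, e]; exact hy h01) (by rw [e, e]; exact hy h12)
    exact iff_of_false (not_lt.2 h.le) fun h' ↦ ny (h'.1 hx) hy
  · have h := realMoebius_det_neg (hM 2).1 (hM 1).1 (hM 0).1 (hx h12) (hx h01)
      (by rw [e, e]; exact hy h12) (by rw [e, e]; exact hy h01)
    exact iff_of_false (not_lt.2 h.le) fun h' ↦ nx (h'.2 hy) hx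
  · have h := realMoebius_det_pos (hM 2).1 (hM 1).1 (hM 0).1 (hx h12) (hx h01)
      (by rw [e, e]; exact hy h12) (by rw [e, e]; exact hy h01)
    exact iff_of_true h (iff_of_false (fun h' ↦ nx h' hx) fun h' ↦ ny h' hy)

/-- **Same orientation, equal cross-ratio ⇒ a real Möbius map of positive determinant** through
the two quadruples (then `z ↦ (a z + b)/(c z + d)` is a conformal automorphism of `ℍₒ`).
[cite: AhlforsCA1979, Ch. 3 §3.1] -/
theorem exists_realMoebius_det_pos_of_crossRatio_eq {x y : Fin 4 → ℝ}
    (hx : StrictMono x ∨ StrictAnti x) (hy : StrictMono y ∨ StrictAnti y)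
    (hor : StrictMono x ↔ StrictMono y) (hcr : crossRatio x = crossRatio y) :
    ∃ a b c d : ℝ, 0 < a * d - b * c ∧
      ∀ i : Fin 4, c * x i + d ≠ 0 ∧ (a * x i + b) / (c * x i + d) = y i := by
  obtain ⟨a, b, c, d, -, hM⟩ := exists_realMoebius_of_crossRatio_eq
    (hx.elim StrictMono.injective StrictAnti.injective)
    (hy.elim StrictMono.injective StrictAnti.injective) hcr
  exact ⟨a, b, c, d, (realMoebius_det_pos_iff hx hy hM).2 hor, hM⟩

/-- **Opposite orientation, equal cross-ratio ⇒ a real Möbius map of negative determinant**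
through the two quadruples (it exchanges `ℍₒ` with the lower half-plane; the anti-conformal
`κ ∘ M`, `κ z = -z̄`, `M` the positive map through `x` and `-y`, is the reflection of `ℍₒ` with
boundary values `xᵢ ↦ yᵢ`). [cite: AhlforsCA1979, Ch. 3 §3.1] -/
theorem exists_realMoebius_det_neg_of_crossRatio_eq {x y : Fin 4 → ℝ}
    (hx : StrictMono x ∨ StrictAnti x) (hy : StrictMono y ∨ StrictAnti y)
    (hor : ¬(StrictMono x ↔ StrictMono y)) (hcr : crossRatio x = crossRatio y) :
    ∃ a b c d : ℝ, a * d - b * c < 0 ∧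
      ∀ i : Fin 4, c * x i + d ≠ 0 ∧ (a * x i + b) / (c * x i + d) = y i := by
  obtain ⟨a, b, c, d, hdet, hM⟩ := exists_realMoebius_of_crossRatio_eq
    (hx.elim StrictMono.injective StrictAnti.injective)
    (hy.elim StrictMono.injective StrictAnti.injective) hcr
  exact ⟨a, b, c, d,
    lt_of_le_of_ne (not_lt.1 fun h ↦ hor ((realMoebius_det_pos_iff hx hy hM).1 h)) hdet, hM⟩

/-! ### The half-plane picture: conformal automorphisms of `ℍₒ` with prescribed boundary values -/

/-- The real Möbius automorphism `ConformalEquiv.realMobius a b c d` of `ℍₒ` (`ad - bc > 0`) has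
boundary value `(a t + b)/(c t + d)` at every regular real point `t`. [folklore] -/
theorem realMobius_hasBoundaryValue {a b c d : ℝ} (hdet : 0 < a * d - b * c) {t : ℝ}
    (ht : c * t + d ≠ 0) :
    (ConformalEquiv.realMobius a b c d hdet).HasBoundaryValue t
      (((a * t + b) / (c * t + d) : ℝ) : ℂ) :=
  ConformalEquiv.hasBoundaryValue_realMobius_trans hdet (ConformalEquiv.refl _) ht
    continuousWithinAt_id

/-- **Same orientation, equal cross-ratio ⇒ a conformal automorphism of `ℍₒ` with boundary values
`xᵢ ↦ yᵢ`** (`ConformalEquiv.realMobius` of `exists_realMoebius_det_pos_of_crossRatio_eq`): the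
half-plane form of "conformal rectangles of equal modulus are conformally equivalent with corners
corresponding". [cite: AhlforsCA1979, Ch. 3 §3.1] -/
theorem exists_conformalEquiv_upperHalfPlaneSet_of_crossRatio_eq {x y : Fin 4 → ℝ}
    (hx : StrictMono x ∨ StrictAnti x) (hy : StrictMono y ∨ StrictAnti y)
    (hor : StrictMono x ↔ StrictMono y) (hcr : crossRatio x = crossRatio y) :
    ∃ M : ConformalEquiv upperHalfPlaneSet upperHalfPlaneSet,
      ∀ i : Fin 4, M.HasBoundaryValue (x i) (y i) := by
  obtain ⟨a, b, c, d, hdet, hM⟩ := exists_realMoebius_det_pos_of_crossRatio_eq hx hy hor hcr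
  refine ⟨ConformalEquiv.realMobius a b c d hdet, fun i ↦ ?_⟩
  have h := realMobius_hasBoundaryValue hdet (hM i).1
  rwa [(hM i).2] at h

/-- **Boundary values of a Möbius automorphism of `ℍₒ`.** If the conformal automorphism `M` of
`ℍₒ` is the Möbius map of `g ∈ SL(2, ℝ)` and has a finite boundary value `p` at the real point
`t`, then `t` is not the pole of `g` and `p = g • t` (at the pole `(g₁₀ z + g₁₁) M z = g₀₀ z + g₀₁`
on `ℍₒ` would tend both to `0 · p` and to `g₀₀ t + g₀₁ ≠ 0`). [folklore] -/
theorem moebius_boundaryValue {M : ConformalEquiv upperHalfPlaneSet upperHalfPlaneSet}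
    {g : Matrix.SpecialLinearGroup (Fin 2) ℝ} (hg : ∀ z : UpperHalfPlane, M (z : ℂ) = ((g • z :) : ℂ))
    {t : ℝ} {p : ℂ} (hp : M.HasBoundaryValue t p) :
    g 1 0 * t + g 1 1 ≠ 0 ∧ p = (((g 0 0 * t + g 0 1) / (g 1 0 * t + g 1 1) : ℝ) : ℂ) := by
  haveI := neBot_nhdsWithin_upperHalfPlaneSet t
  have hp' : Tendsto (moebiusFun g) (𝓝[upperHalfPlaneSet] ((t : ℝ) : ℂ)) (𝓝 p) :=
    hp.congr' (eventually_nhdsWithin_of_forall fun z hz ↦ by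
      rw [← coe_smul_eq_moebiusFun g ⟨z, hz⟩]
      exact hg ⟨z, hz⟩)
  -- the affine maps `z ↦ u z + v` are continuous
  have hlin : ∀ u v : ℝ, Tendsto (fun z : ℂ ↦ (u : ℂ) * z + v)
      (𝓝[upperHalfPlaneSet] ((t : ℝ) : ℂ)) (𝓝 ((u : ℂ) * t + v)) := fun u v ↦
    ((by fun_prop : Continuous fun z : ℂ ↦ (u : ℂ) * z + v).tendsto _).mono_left nhdsWithin_le_nhds
  -- on `ℍₒ` the denominator does not vanish, so `den · M = num` there
  have hprod : (fun z : ℂ ↦ (((g 1 0 : ℝ) : ℂ) * z + (g 1 1 : ℝ)) * moebiusFun g z)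
      =ᶠ[𝓝[upperHalfPlaneSet] ((t : ℝ) : ℂ)] fun z ↦ ((g 0 0 : ℝ) : ℂ) * z + (g 0 1 : ℝ) :=
    eventually_nhdsWithin_of_forall fun z hz ↦ by
      simp only [moebiusFun]
      rw [mul_div_cancel₀ _ (sl2_denom_ne_zero g hz)]
  by_cases hpole : g 1 0 * t + g 1 1 = 0
  · exfalso
    have h0 : ((g 1 0 : ℝ) : ℂ) * t + (g 1 1 : ℝ) = 0 := by exact_mod_cast hpole
    have h1 : Tendsto (fun z : ℂ ↦ ((g 0 0 : ℝ) : ℂ) * z + (g 0 1 : ℝ))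
        (𝓝[upperHalfPlaneSet] ((t : ℝ) : ℂ)) (𝓝 (0 * p)) := by
      rw [← h0]
      exact ((hlin _ _).mul hp').congr' hprod
    have h2 : ((g 0 0 : ℝ) : ℂ) * t + (g 0 1 : ℝ) = 0 := by
      rw [tendsto_nhds_unique (hlin _ _) h1, zero_mul]
    have h3 : g 0 0 * t + g 0 1 = 0 := by exact_mod_cast h2
    -- `(t, 1)` is in the kernel of `g`, contradicting `det g = 1`
    have hdet := sl2_det_entries g
    rw [show g 1 1 = -(g 1 0 * t) by linarith, show g 0 1 = -(g 0 0 * t) by linarith] at hdet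
    have : (0 : ℝ) = 1 := by linear_combination hdet
    exact zero_ne_one this
  · refine ⟨hpole, ?_⟩
    have h1 := tendsto_nhds_unique hp' ((hlin _ _).div (hlin _ _) (by exact_mod_cast hpole))
    rw [h1]
    push_cast
    rfl

/-- **Opposite orientation ⇒ NO conformal automorphism of `ℍₒ` has boundary values `xᵢ ↦ yᵢ`**:
such an automorphism is a real Möbius map of determinant `1` (`Aut(ℍₒ) = PSL(2, ℝ)`,
`ConformalEquiv.exists_specialLinearGroup_eq`), finite at the four points with the prescribed
values (`moebius_boundaryValue`), contradicting `realMoebius_det_pos_iff`; so in the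
opposite-orientation case of the stub only an anti-conformal (mirror) identification exists.
[cite: AhlforsCA1979, Ch. 3 §3.1] -/
theorem not_exists_conformalEquiv_upperHalfPlaneSet_of_orientation_ne {x y : Fin 4 → ℝ}
    (hx : StrictMono x ∨ StrictAnti x) (hy : StrictMono y ∨ StrictAnti y)
    (hor : ¬(StrictMono x ↔ StrictMono y)) :
    ¬∃ M : ConformalEquiv upperHalfPlaneSet upperHalfPlaneSet,
      ∀ i : Fin 4, M.HasBoundaryValue (x i) (y i) := by
  rintro ⟨M, hM⟩
  obtain ⟨g, hg⟩ := M.exists_specialLinearGroup_eq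
  have hb := fun i ↦ moebius_boundaryValue hg (hM i)
  have hM' : ∀ i : Fin 4, g 1 0 * x i + g 1 1 ≠ 0 ∧
      (g 0 0 * x i + g 0 1) / (g 1 0 * x i + g 1 1) = y i := fun i ↦
    ⟨(hb i).1, by exact_mod_cast (hb i).2.symm⟩
  have hdet : (0 : ℝ) < g 0 0 * g 1 1 - g 0 1 * g 1 0 := by rw [sl2_det_entries g]; exact one_pos
  exact hor ((realMoebius_det_pos_iff hx hy hM').1 hdet)

/-! ### The domain picture: conformal rectangles of equal modulus -/

/-- **Three-point normalisation of a uniformizing datum.** If `(φ, y)` uniformizes the conformal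
rectangle `R` and `x` is a quadruple of the same orientation and cross-ratio, then `R` has a
uniformizing datum with boundary quadruple `x`: `ψ = φ ∘ M`, `M` the positive-determinant real
Möbius map with `M xᵢ = yᵢ` (`ConformalEquiv.hasBoundaryValue_realMobius_trans`). Same content as
the tree's `UniformizingNormalForm.exists_isUniformizing_of_crossRatio_eq`, hypotheses in the shape
of the stub. [cite: AhlforsCA1979, Ch. 3 §3.1] -/
theorem exists_isUniformizing_of_crossRatio_eq {R : ConformalRectangle}
    {φ : ConformalEquiv upperHalfPlaneSet R.carrier} {x y : Fin 4 → ℝ}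
    (hφ : R.IsUniformizing φ y) (hx : StrictMono x ∨ StrictAnti x)
    (hor : StrictMono x ↔ StrictMono y) (hcr : crossRatio x = crossRatio y) :
    ∃ ψ : ConformalEquiv upperHalfPlaneSet R.carrier, R.IsUniformizing ψ x := by
  obtain ⟨a, b, c, d, hdet, hM⟩ := exists_realMoebius_det_pos_of_crossRatio_eq hx hφ.1 hor hcr
  refine ⟨(ConformalEquiv.realMobius a b c d hdet).trans φ, hx, fun i ↦ ?_⟩
  refine ConformalEquiv.hasBoundaryValue_realMobius_trans hdet φ (hM i).1 ?_
  rw [(hM i).2]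
  exact hφ.2 i

/-- **Conformal rectangles with uniformizing data of equal cross-ratio and equal orientation are
conformally equivalent as marked domains**: there is a conformal equivalence `Ψ : Ω → Ω'` with
boundary value `R'.pt i` at `R.pt i` for each marked point. `Ψ = ψ ∘ φ⁻¹` with `(ψ, x)` the
renormalised datum of `R'` (`exists_isUniformizing_of_crossRatio_eq`) and `φ⁻¹ → xᵢ` at `R.pt i`
by Carathéodory's theorem (`JordanDomain.exists_continuousOn_extension_holds`,
`JordanDomain.tendsto_symm_nhds`). This is the precise geometric input of "conformal covariance"
in the stub. [cite: AhlforsCA1979, Ch. 6 §1.1 Thm. 1] -/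
theorem exists_conformalEquiv_hasBoundaryValue_pt {R R' : ConformalRectangle}
    {φ : ConformalEquiv upperHalfPlaneSet R.carrier} {φ' : ConformalEquiv upperHalfPlaneSet R'.carrier}
    {x x' : Fin 4 → ℝ} (hφ : R.IsUniformizing φ x) (hφ' : R'.IsUniformizing φ' x')
    (hor : StrictMono x ↔ StrictMono x') (hcr : crossRatio x = crossRatio x') :
    ∃ Ψ : ConformalEquiv R.carrier R'.carrier, ∀ i : Fin 4, Ψ.HasBoundaryValue (R.pt i) (R'.pt i) := by
  obtain ⟨ψ, hψ⟩ := exists_isUniformizing_of_crossRatio_eq hφ' hφ.1 hor hcr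
  obtain ⟨Φ, hΦc, hΦeq, hbij, -⟩ :=
    JordanDomain.exists_continuousOn_extension_holds R.toJordanDomain (cayley.symm.trans φ)
  refine ⟨φ.symm.trans ψ, fun i ↦ ?_⟩
  have hsymm : Tendsto φ.symm (𝓝[R.carrier] (R.pt i)) (𝓝[upperHalfPlaneSet] ((x i : ℝ) : ℂ)) :=
    tendsto_nhdsWithin_iff.2 ⟨JordanDomain.tendsto_symm_nhds φ hΦc hΦeq hbij.injOn (hφ.2 i),
      eventually_nhdsWithin_of_forall fun z hz ↦ φ.symm_mapsTo hz⟩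
  exact (hψ.2 i).comp hsymm

/-- **The orientation of a uniformizing quadruple is an invariant of the conformal rectangle**
(its chirality): two data `(φ, x)`, `(φ', x')` of the same `R` have `x` increasing iff `x'` is,
because `φ⁻¹ ∘ φ'` is a conformal automorphism of `ℍₒ` with boundary values `x'ᵢ ↦ xᵢ`
(Carathéodory), i.e. a real Möbius map of determinant `1 > 0` through the two quadruples
(`moebius_boundaryValue`, `realMoebius_det_pos_iff`). Hence in the stub "opposite orientations"
means exactly "`R'` has the chirality of the mirror image of `R`". [cite: AhlforsCA1979, Ch. 3 §3.1] -/
theorem isUniformizing_strictMono_iff {R : ConformalRectangle}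
    {φ φ' : ConformalEquiv upperHalfPlaneSet R.carrier} {x x' : Fin 4 → ℝ}
    (hφ : R.IsUniformizing φ x) (hφ' : R.IsUniformizing φ' x') : StrictMono x ↔ StrictMono x' := by
  obtain ⟨Φ, hΦc, hΦeq, hbij, -⟩ :=
    JordanDomain.exists_continuousOn_extension_holds R.toJordanDomain (cayley.symm.trans φ)
  have hlim : ∀ i, (φ'.trans φ.symm).HasBoundaryValue (x' i) (x i) := fun i ↦ by
    have h1 : Tendsto φ' (𝓝[upperHalfPlaneSet] ((x' i : ℝ) : ℂ)) (𝓝[R.carrier] (R.pt i)) :=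
      tendsto_nhdsWithin_iff.2 ⟨hφ'.2 i, eventually_nhdsWithin_of_forall fun z hz ↦ φ'.mapsTo hz⟩
    exact (JordanDomain.tendsto_symm_nhds φ hΦc hΦeq hbij.injOn (hφ.2 i)).comp h1
  obtain ⟨g, hg⟩ := (φ'.trans φ.symm).exists_specialLinearGroup_eq
  have hb := fun i ↦ moebius_boundaryValue hg (hlim i)
  have hM' : ∀ i : Fin 4, g 1 0 * x' i + g 1 1 ≠ 0 ∧
      (g 0 0 * x' i + g 0 1) / (g 1 0 * x' i + g 1 1) = x i := fun i ↦
    ⟨(hb i).1, by exact_mod_cast (hb i).2.symm⟩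
  have hdet : (0 : ℝ) < g 0 0 * g 1 1 - g 0 1 * g 1 0 := by rw [sl2_det_entries g]; exact one_pos
  exact ((realMoebius_det_pos_iff hφ'.1 hφ.1 hM').1 hdet).symm

/-- **Registered form** (sub-goal `stub_higherJetLimitsConformal_markedEquivalence` of stub 3
`stub_higherJetLimitsConformal` of crux stmt-CriticalPhenomena-5560): conformal rectangles with
uniformizing data of equal orientation and equal cross-ratio are conformally equivalent as marked
domains (`exists_conformalEquiv_hasBoundaryValue_pt`). [cite: AhlforsCA1979, Ch. 6 §1.1 Thm. 1] -/
theorem stub_higherJetLimitsConformal_markedEquivalence :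
    ∀ (R R' : Literature.Probability.RandomPlanarGeometry.ConformalRectangle) (φ : Literature.Probability.RandomPlanarGeometry.ConformalEquiv UpperHalfPlane.upperHalfPlaneSet R.carrier) (x : Fin 4 → ℝ) (φ' : Literature.Probability.RandomPlanarGeometry.ConformalEquiv UpperHalfPlane.upperHalfPlaneSet R'.carrier) (x' : Fin 4 → ℝ), R.IsUniformizing φ x → R'.IsUniformizing φ' x' → (StrictMono x ↔ StrictMono x') → Literature.Probability.RandomPlanarGeometry.crossRatio x = Literature.Probability.RandomPlanarGeometry.crossRatio x' → ∃ Ψ : Literature.Probability.RandomPlanarGeometry.ConformalEquiv R.carrier R'.carrier, ∀ i : Fin 4, Ψ.HasBoundaryValue (R.pt i) (R'.pt i) := by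
  intro R R' φ x φ' x' h h' hor hcr
  exact exists_conformalEquiv_hasBoundaryValue_pt h h' hor hcr

end Summit.CriticalPhenomena.CardyFormulaZ2.Theorems.CardyQContinuation
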